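import Literature.RingTheory.CohomologyAnnihilator.AffineDomainAnnihilator
import Literature.RingTheory.CohomologyAnnihilator.StrongGeneratorInduction
import HarnessLib

/-!
# Theorem 5.4 of Iyengar–Takahashi reduced to the descent step alone

Topic: `Literature/RingTheory/CohomologyAnnihilator`.  `StrongGeneratorReduction.lean` proves the
named fact `singEqVCa_essFiniteType` ([IyengarTakahashi2014, Theorem 5.4]: for `R` a localisation
of a finitely generated algebra of Krull dimension `d` over a field,
`V(ca R) = V(ca^{2d+1} R) = Sing R`) from its three printed inputs `h₃₆`, `h₅₂`, `h_desc`.  Two of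
them are now theorems of the tree:

* `h₃₆` = `cohomologyAnnihilatorOfDegree_ne_bot_of_perfectField` (`AffineDomainAnnihilator.lean`:
  Theorem 3.6 over perfect fields via separable Noether normalisation);
* `h₅₂` = `exists_strongGenerator_of_forall_prime` (`StrongGeneratorInduction.lean`: Theorem 5.2,
  the Dao–Takahashi induction).

This file records the resulting ONE-input reduction `singEqVCa_essFiniteType_of_descent`: the
named fact follows from the descent step of the proof of Theorem 5.4 alone — a strong generator of
`mod (K ⊗ₖ A)` with parameter `d`, for `K` an algebraically closed algebraic extension of `k` and
`A` of finite type over `k`, yields one of `mod A` with parameter `d` ("we may adapt the argument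
in [Keller–Van den Bergh, Prop. 5.1.2]", with the compactness Lemma 4.8).  What remains UNPROVED
towards `singEqVCa_essFiniteType_holds` is exactly that statement (binder below, verbatim the
`h_desc` of `singEqVCa_essFiniteType_of_inputs`).

## References

* S. B. Iyengar, R. Takahashi, *Annihilation of cohomology and strong generation of module
  categories*, IMRN 2016; arXiv:1404.1476 — Theorems 3.6, 5.2, 5.4, Lemma 4.8.
  [`IyengarTakahashi2014`]
-/

noncomputable section

open CategoryTheory
open scoped TensorProduct

universe u

namespace Literature.RingTheory.CohomologyAnnihilator

/-- **Theorem 5.4 of [IyengarTakahashi2014] from the descent step alone.** Given the descent of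
strong generators from `mod (K ⊗ₖ A)` (`K = k̄`) to `mod A` (the last paragraph of the proof of
Theorem 5.4), `V(ca R) = V(ca^{2d+1} R) = Sing R` holds for every localisation `R` of a finitely
generated algebra of Krull dimension `d` over any field: combine
`singEqVCa_essFiniteType_of_inputs` with the proved inputs
`cohomologyAnnihilatorOfDegree_ne_bot_of_perfectField` (Thm. 3.6, perfect ground field) and
`exists_strongGenerator_of_forall_prime` (Thm. 5.2). [cite: IyengarTakahashi2014, Thm. 5.4 (proof)] -/
theorem singEqVCa_essFiniteType_of_descent
    (h_desc : ∀ (k : Type u) [Field k] (K : Type u) [Field K] [Algebra k K] [IsAlgClosed K]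
      [Algebra.IsAlgebraic k K] (A : Type u) [CommRing A] [Algebra k A], Algebra.FiniteType k A →
      ∀ d : ℕ, (∃ G : ModuleCat.{u} (K ⊗[k] A), Module.Finite (K ⊗[k] A) G ∧ ∃ n : ℕ,
          ∀ M : ModuleCat.{u} (K ⊗[k] A), Module.Finite (K ⊗[k] A) M →
            ∃ K' : ModuleCat.{u} (K ⊗[k] A), IsSyzygy d M K' ∧ InTower G n K') →
        ∃ G : ModuleCat.{u} A, Module.Finite A G ∧ ∃ n : ℕ, ∀ M : ModuleCat.{u} A,
          Module.Finite A M → ∃ K' : ModuleCat.{u} A, IsSyzygy d M K' ∧ InTower G n K') :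
    singEqVCa_essFiniteType.{u} :=
  singEqVCa_essFiniteType_of_thm52_of_descent exists_strongGenerator_of_forall_prime h_desc

end Literature.RingTheory.CohomologyAnnihilator

end
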